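import Literature.Probability.RandomPlanarGeometry.TangentAtSLE6Proofs
import Literature.Probability.RandomPlanarGeometry.TangentAtSLE6Sectors
import Literature.Probability.RandomPlanarGeometry.ZoomFlow
import Literature.Probability.RandomPlanarGeometry.ChordalRestrictionMarkov
import Literature.Probability.RandomPlanarGeometry.ChordalReversibility
import HarnessLib

/-!
# Route `SAWInfinitesimalRigidity`: vocabulary of item `InfinitesimalRigidity` (IR0, stmt-CriticalPhenomena-5236)

Definitions file (reviewed) for the objects the informal item IR0 ("`T_0(SLE(8/3)) = sym₀(2)`")
posits — the route's definition request `defn-RestrictionMarkovTangentSpace`, which after nine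
literature-seat attempts was blocked `needs-human` with the ruling "route-posited object (no printed
definition) — belongs in a prover-written `Theorems/SAWInfinitesimalRigidityDefs.lean`" (this file).
Vocabulary: the first-order calculus of `Literature/…/TangentAtSLE6.lean` (`Deformation`, `coord`,
`IsDeformationCurve`, `velocity`, `tangentCone`, `Deformation.IsCovariantUnder`), the pull-backs
`ChordalFamily.pullback` of `TangentAtSLE6Sectors.lean`, and the named axioms of the sibling route
SAWRestrictionRigidity (`IsRestriction`, `IsRestrictionMarkov`, `IsReversible`).

* `exactRestrictionMarkovClass` — the class `𝒱`: chordal, EXACT two-sided restriction,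
  restriction-coupled Markov kernel, reversible, translation covariant, a.s. simple and boundary
  avoiding (the hypotheses of R* = `SAWRestrictionRigidity.Rigidity` / `LocalRigidity` with the
  similarity clause cut down to translations; the named predicates are definitionally the route's
  inline clauses, `isRestrictionMarkov_iff`, `isReversible_iff`); `latticeExactClass` — `𝒱` with
  covariance under all `z ↦ r·i^k·z + w` added back;
* `weightDeformations 𝒯 y` (eigenvectors of the dilation action, `v (r·D) f = r^y · v D (f ∘ r_*)`;
  weight `0` = `IsCovariantUnder 𝒯 v (dil r)` ∀ `r > 0`, `mem_weightDeformations_zero_iff`) and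
  `restrictionMarkovTangentSpace y 𝒯 F` = **`T_y(F)` along `𝒯`** (weight-`y` tangent vectors at `F`
  of `𝒱`: velocities of `C¹`-along-`𝒯` curves in `𝒱` through `F`);
* the weight-0 directions: `stretchMap`/`stretchHomeomorph u hu t = exp (t M_u)` (`M_u z = u z̄`,
  `|u| = 1`; `sym₀(2) = {z ↦ q z̄}`), `stretchCurve u hu F : t ↦ (L_t)_* F`,
  `stretchVelocities 𝒯 F = {a • velocity 𝒯 (stretchCurve u hu F)}`; IR0 then READS
  `restrictionMarkovTangentSpace 0 𝒯 F ⊆ stretchVelocities 𝒯 F` for the SLE(8/3) family `F` (not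
  declared here — statements are the planner's);
* `quarterTurn = similarity i 0` and the sign lemma `R L_t R⁻¹ = L_{-t}` (`I_mul_stretchMap`,
  `stretchHomeomorph_trans_quarterTurn`, `quarterTurn_symm_trans_stretchHomeomorph_trans_quarterTurn`);
* `avoidanceObservables` (constants + indicators of `{γ ⊆ closure D'}`), stable under every plane
  homeomorphism (`mem_avoidanceObservables_iff_comp_map`).

Companion helper files: `…QuarterTurnSign.lean` (the sign lemma for tangent vectors; IR0 ⇒ the
tangent cone of `latticeExactClass` at `F` is `{0}`), `…ExactClassTransport.lean` (`𝒱` is invariant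
under stretches, dilations, the quarter-turn; the stretch curve stays in `𝒱`).

## Design notes (what is NOT here)

* KINEMATIC, NOT ZARISKI: the request's `T_y` are solutions of the LINEARISED identities with the
  kernel's deformation as extra data; the tree's notion (`tangentCone`) is velocities of curves IN
  the class, where the kernel rides along inside `𝒱`. Kinematic `T_y ⊆` Zariski `T_y`, so IR0 typed
  here is implied by (weaker than) the card's claim. No Jordan blocks: `weightDeformations` are
  genuine eigenvectors (a velocity of a curve of dilation-covariant families is one).
* `stretchVelocities` does not ask the stretch curve to be `C¹` along `𝒯` (so `0` is always one
  and "`T_0 ⊆ stretchVelocities`" is never vacuously false); "`sym₀(2) ⊆ T_0`" is a separate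
  differentiability statement. Weight convention: the fugacity tilt has `y = 4/3` as in the card.
* No statement of the route is declared and no SLE fact is used.

## References

* V. Beffara, *Is critical 2D percolation universal?*, Progr. Probab. 60 (2008), §2.2, Prop. 4
  [Beffara2008Universal] (stretches `L_* F` of a scaling limit; the order-4 symmetry of `ℤ²`).
* G. Lawler, O. Schramm, W. Werner, *Conformal restriction: the chordal case*, JAMS 16 (2003) §1, §3
  [LawlerSchrammWerner2003Restriction].
* W. Werner, *Lectures on two-dimensional critical percolation* (2007) §3.2 [Werner2007].
-/

noncomputable section

open Set MeasureTheory Topology Filter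
open scoped NNReal ENNReal ComplexConjugate

namespace Summit.CriticalPhenomena.SAWScalingLimit.Theorems.InfinitesimalRigidity

open Literature.Probability.RandomPlanarGeometry
open Literature.Probability.RandomPlanarGeometry.ChordalFamily

/-! ### Area-preserving linear stretches `exp (t M_u)`, `M_u z = u z̄` (`|u| = 1`) -/

/-- The linear stretch `L_t^{(u)} z = cosh t · z + sinh t · u · z̄` of the plane: for `|u| = 1`,
`u = e^{2iθ}`, this is `exp (t M_u)` with `M_u z = u z̄` the traceless symmetric matrix stretching
by `e^{t}` along `e^{iθ}ℝ` and by `e^{-t}` along `i e^{iθ}ℝ` (`M_u² = 1`, so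
`exp (t M_u) = cosh t + sinh t · M_u`). The maps `z ↦ q z̄`, `q ∈ ℂ`, are exactly `sym₀(2)`, the
directions of Beffara's linear modulus. [cite: Beffara2008Universal, §2.2] -/
def stretchMap (u : ℂ) (t : ℝ) (z : ℂ) : ℂ :=
  (Real.cosh t : ℂ) * z + (Real.sinh t : ℂ) * u * conj z

/-- `L_0 = id`. [folklore] -/
@[simp] theorem stretchMap_zero (u z : ℂ) : stretchMap u 0 z = z := by
  simp [stretchMap]

/-- `L_{-t} ∘ L_t = id` for a unit direction `u` (`cosh² - sinh² = 1`, `u ū = 1`). [folklore] -/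
theorem stretchMap_neg_stretchMap {u : ℂ} (hu : ‖u‖ = 1) (t : ℝ) (z : ℂ) :
    stretchMap u (-t) (stretchMap u t z) = z := by
  have h1 : (Real.cosh t : ℂ) ^ 2 - (Real.sinh t : ℂ) ^ 2 = 1 := by
    rw [Complex.ofReal_cosh, Complex.ofReal_sinh]
    exact Complex.cosh_sq_sub_sinh_sq _
  have hu' : u * conj u = 1 := by
    rw [Complex.mul_conj, Complex.normSq_eq_norm_sq, hu]
    simp
  simp only [stretchMap, Real.cosh_neg, Real.sinh_neg, Complex.ofReal_neg, map_add, map_mul,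
    Complex.conj_ofReal, Complex.conj_conj]
  linear_combination z * h1 - (Real.sinh t : ℂ) ^ 2 * z * hu'

/-- THE QUARTER-TURN SIGN LEMMA, pointwise: `i · L_t (w) = L_{-t} (i · w)`, i.e.
`R L_t R⁻¹ = L_{-t}` for the quarter-turn `R z = i z` — conjugating a traceless symmetric matrix by
the rotation of the square lattice reverses its sign (`R M_u R⁻¹ = -M_u` on `sym₀(2)`; Beffara
2008, proof of Prop. 4: the order-`4` symmetry pins the modulus). [cite: Beffara2008Universal, Prop. 4] -/
theorem I_mul_stretchMap (u : ℂ) (t : ℝ) (w : ℂ) :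
    Complex.I * stretchMap u t w = stretchMap u (-t) (Complex.I * w) := by
  simp only [stretchMap, Real.cosh_neg, Real.sinh_neg, Complex.ofReal_neg, map_mul,
    Complex.conj_I]
  ring

/-- The stretch `L_t^{(u)} = exp (t M_u)` as a homeomorphism of the plane, with inverse
`L_{-t}^{(u)}` (`|u| = 1`). [folklore] -/
def stretchHomeomorph (u : ℂ) (hu : ‖u‖ = 1) (t : ℝ) : ℂ ≃ₜ ℂ where
  toFun := stretchMap u t
  invFun := stretchMap u (-t)
  left_inv z := stretchMap_neg_stretchMap hu t z
  right_inv z := by simpa only [neg_neg] using stretchMap_neg_stretchMap hu (-t) z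
  continuous_toFun := by
    change Continuous fun z => (Real.cosh t : ℂ) * z + (Real.sinh t : ℂ) * u * conj z
    exact (continuous_const.mul continuous_id).add
      (continuous_const.mul Complex.continuous_conj)
  continuous_invFun := by
    change Continuous fun z => (Real.cosh (-t) : ℂ) * z + (Real.sinh (-t) : ℂ) * u * conj z
    exact (continuous_const.mul continuous_id).add
      (continuous_const.mul Complex.continuous_conj)

/-- Pointwise formula. [folklore] -/
@[simp] theorem stretchHomeomorph_apply (u : ℂ) (hu : ‖u‖ = 1) (t : ℝ) (z : ℂ) :
    stretchHomeomorph u hu t z = stretchMap u t z := rfl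

/-- The inverse stretch is the stretch with the opposite parameter. [folklore] -/
theorem stretchHomeomorph_symm (u : ℂ) (hu : ‖u‖ = 1) (t : ℝ) :
    (stretchHomeomorph u hu t).symm = stretchHomeomorph u hu (-t) :=
  Homeomorph.ext fun _ => rfl

/-- `L_0 = id`. [folklore] -/
theorem stretchHomeomorph_zero (u : ℂ) (hu : ‖u‖ = 1) :
    stretchHomeomorph u hu 0 = Homeomorph.refl ℂ :=
  Homeomorph.ext fun z => stretchMap_zero u z

/-- A stretch is Lipschitz (it is real-linear). [folklore] -/
theorem lipschitzWith_stretchHomeomorph (u : ℂ) (hu : ‖u‖ = 1) (t : ℝ) :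
    LipschitzWith (‖(Real.cosh t : ℂ)‖₊ + ‖(Real.sinh t : ℂ) * u‖₊)
      ((stretchHomeomorph u hu t : ℂ ≃ₜ ℂ) : C(ℂ, ℂ)) :=
  LipschitzWith.of_dist_le_mul fun x y => by
    change dist (stretchMap u t x) (stretchMap u t y) ≤ _
    have h : stretchMap u t x - stretchMap u t y =
        (Real.cosh t : ℂ) * (x - y) + (Real.sinh t : ℂ) * u * (conj x - conj y) := by
      unfold stretchMap; ring
    rw [dist_eq_norm, dist_eq_norm, h, ← map_sub, NNReal.coe_add, coe_nnnorm, coe_nnnorm]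
    calc ‖(Real.cosh t : ℂ) * (x - y) + (Real.sinh t : ℂ) * u * conj (x - y)‖
        ≤ ‖(Real.cosh t : ℂ) * (x - y)‖ + ‖(Real.sinh t : ℂ) * u * conj (x - y)‖ :=
          norm_add_le _ _
      _ = (‖(Real.cosh t : ℂ)‖ + ‖(Real.sinh t : ℂ) * u‖) * ‖x - y‖ := by
          rw [norm_mul, norm_mul ((Real.sinh t : ℂ) * u), Complex.norm_conj]; ring

/-- Push-forward of curve classes along a stretch is Borel measurable. [folklore] -/
theorem measurable_curveClassMap_stretchHomeomorph (u : ℂ) (hu : ‖u‖ = 1) (t : ℝ) :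
    Measurable (CurveClass.map ((stretchHomeomorph u hu t : ℂ ≃ₜ ℂ) : C(ℂ, ℂ))) :=
  (CurveClass.lipschitzWith_map (lipschitzWith_stretchHomeomorph u hu t)).continuous.measurable

/-! ### The quarter-turn and the sign lemma for homeomorphisms -/

/-- The quarter-turn `R z = i z` of the plane (the rotation of the square lattice), as the
similarity `similarity i 0`. [folklore] -/
def quarterTurn : ℂ ≃ₜ ℂ := similarity Complex.I Complex.I_ne_zero 0

/-- Pointwise formula. [folklore] -/
@[simp] theorem quarterTurn_apply (z : ℂ) : quarterTurn z = Complex.I * z := by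
  simp [quarterTurn]

/-- THE SIGN LEMMA for homeomorphisms: `R ∘ L_t = L_{-t} ∘ R`. [cite: Beffara2008Universal, Prop. 4] -/
theorem stretchHomeomorph_trans_quarterTurn (u : ℂ) (hu : ‖u‖ = 1) (t : ℝ) :
    (stretchHomeomorph u hu t).trans quarterTurn = quarterTurn.trans (stretchHomeomorph u hu (-t)) :=
  Homeomorph.ext fun z => by
    simp only [Homeomorph.trans_apply, stretchHomeomorph_apply, quarterTurn_apply]
    exact I_mul_stretchMap u t z

/-- Equivalently `R L_t R⁻¹ = L_{-t}`. [cite: Beffara2008Universal, Prop. 4] -/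
theorem quarterTurn_symm_trans_stretchHomeomorph_trans_quarterTurn (u : ℂ) (hu : ‖u‖ = 1) (t : ℝ) :
    (quarterTurn.symm.trans (stretchHomeomorph u hu t)).trans quarterTurn =
      stretchHomeomorph u hu (-t) :=
  Homeomorph.ext fun z => by
    have h := I_mul_stretchMap u t (quarterTurn.symm z)
    rw [← quarterTurn_apply, ← quarterTurn_apply, Homeomorph.apply_symm_apply] at h
    simpa only [Homeomorph.trans_apply, stretchHomeomorph_apply] using h

/-- Push-forward of curve classes along the quarter-turn is Borel measurable. [folklore] -/
theorem measurable_curveClassMap_quarterTurn :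
    Measurable (CurveClass.map ((quarterTurn : ℂ ≃ₜ ℂ) : C(ℂ, ℂ))) :=
  measurable_curveClassMap_similarity _ _ _

/-- … and so is push-forward along its inverse. [folklore] -/
theorem measurable_curveClassMap_quarterTurn_symm :
    Measurable (CurveClass.map ((quarterTurn.symm : ℂ ≃ₜ ℂ) : C(ℂ, ℂ))) := by
  rw [quarterTurn, similarity_symm]
  exact measurable_curveClassMap_similarity _ _ _

/-! ### Avoidance observables: a homeomorphism-stable test class -/

/-- The **avoidance observables**: constants and the indicators of the sub-domain avoidance events
`{γ ⊆ closure D'}` (`CurveClass.rangeSubset`), `D'` a Dobrushin domain — the coordinates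
`P D {γ ⊆ cl D'}` in which two-sided restriction (`ChordalFamily.IsRestriction`, LSW 2003 §3) and
the closeness clause of `LocalRigidity` are written. [cite: LawlerSchrammWerner2003Restriction, §3] -/
def avoidanceObservables : Set (CurveClass ℂ → ℝ) :=
  {f | ∃ a : ℝ, f = fun _ => a} ∪
    {f | ∃ D' : DobrushinDomain, f = (CurveClass.rangeSubset (closure D'.carrier)).indicator 1}

/-- Pulling back an avoidance event along a push-forward: `{γ : φ_* γ ⊆ S} = {γ ⊆ φ⁻¹ S}`.
[folklore] -/
theorem curveClass_preimage_map_rangeSubset (φ : C(ℂ, ℂ)) (S : Set ℂ) :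
    CurveClass.map φ ⁻¹' CurveClass.rangeSubset S = CurveClass.rangeSubset (φ ⁻¹' S) := by
  ext c
  simp [Set.image_subset_iff]

/-- The avoidance EVENT of `D'` pulled back along `φ_*` is the avoidance event of the marked
domain `φ⁻¹ D'` (homeomorphisms commute with closure). [folklore] -/
theorem curveClass_preimage_map_rangeSubset_closure (φ : ℂ ≃ₜ ℂ) (D' : DobrushinDomain) :
    CurveClass.map ((φ : ℂ ≃ₜ ℂ) : C(ℂ, ℂ)) ⁻¹' CurveClass.rangeSubset (closure D'.carrier) =
      CurveClass.rangeSubset (closure (D'.map φ.symm).carrier) := by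
  rw [curveClass_preimage_map_rangeSubset, MarkedDomain.carrier_map]
  change CurveClass.rangeSubset ((φ : ℂ → ℂ) ⁻¹' closure D'.carrier) = _
  rw [Homeomorph.preimage_closure, ← Homeomorph.image_symm]

/-- The avoidance indicator of `D'` tested on `φ_* γ` is the avoidance indicator of `φ⁻¹ D'`.
[folklore] -/
theorem indicator_rangeSubset_comp_map (φ : ℂ ≃ₜ ℂ) (D' : DobrushinDomain) :
    (CurveClass.rangeSubset (closure D'.carrier)).indicator (1 : CurveClass ℂ → ℝ) ∘
        CurveClass.map ((φ : ℂ ≃ₜ ℂ) : C(ℂ, ℂ)) =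
      (CurveClass.rangeSubset (closure (D'.map φ.symm).carrier)).indicator 1 := by
  have hS := curveClass_preimage_map_rangeSubset_closure φ D'
  funext c
  simp only [Function.comp_apply]
  by_cases hc : CurveClass.map ((φ : ℂ ≃ₜ ℂ) : C(ℂ, ℂ)) c ∈
      CurveClass.rangeSubset (closure D'.carrier)
  · rw [Set.indicator_of_mem hc, Set.indicator_of_mem (show c ∈ _ by rwa [← hS])]
    rfl
  · rw [Set.indicator_of_notMem hc, Set.indicator_of_notMem (show c ∉ _ by rwa [← hS])]

/-- Avoidance observables pull back to avoidance observables along every plane homeomorphism.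
[folklore] -/
theorem comp_map_mem_avoidanceObservables (φ : ℂ ≃ₜ ℂ) {f : CurveClass ℂ → ℝ}
    (hf : f ∈ avoidanceObservables) :
    f ∘ CurveClass.map ((φ : ℂ ≃ₜ ℂ) : C(ℂ, ℂ)) ∈ avoidanceObservables := by
  rcases hf with ⟨a, rfl⟩ | ⟨D', rfl⟩
  · exact Or.inl ⟨a, rfl⟩
  · exact Or.inr ⟨D'.map φ.symm, indicator_rangeSubset_comp_map φ D'⟩

/-- `(f ∘ φ_*) ∘ φ⁻¹_* = f`. [folklore] -/
theorem comp_map_comp_map_symm (φ : ℂ ≃ₜ ℂ) (f : CurveClass ℂ → ℝ) :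
    (f ∘ CurveClass.map ((φ : ℂ ≃ₜ ℂ) : C(ℂ, ℂ))) ∘ CurveClass.map ((φ.symm : ℂ ≃ₜ ℂ) : C(ℂ, ℂ)) =
      f := by
  rw [Function.comp_assoc, ← CurveClass.map_homeomorph_trans, Homeomorph.symm_trans_self,
    CurveClass.map_homeomorph_refl, Function.comp_id]

/-- The class of avoidance observables is stable under every plane homeomorphism (both ways); in
particular under the quarter-turn and the dilations. [folklore] -/
theorem mem_avoidanceObservables_iff_comp_map (φ : ℂ ≃ₜ ℂ) (f : CurveClass ℂ → ℝ) :
    f ∈ avoidanceObservables ↔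
      f ∘ CurveClass.map ((φ : ℂ ≃ₜ ℂ) : C(ℂ, ℂ)) ∈ avoidanceObservables :=
  ⟨comp_map_mem_avoidanceObservables φ, fun h => by
    simpa only [comp_map_comp_map_symm] using comp_map_mem_avoidanceObservables φ.symm h⟩

/-! ### Pull-backs along constant fields (`φ_* P`) and the stretch curves through a family -/

/-- A pull-back along a CONSTANT field `φ⁻¹` is the image family `φ_* P : D ↦ φ_* (P (φ⁻¹ D))`.
[folklore] -/
theorem pullback_const_apply (P : ChordalFamily) (φ : ℂ ≃ₜ ℂ) (D : DobrushinDomain) :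
    pullback P (fun _ => φ.symm) D = (P (D.map φ.symm)).map (CurveClass.map ((φ : ℂ ≃ₜ ℂ) : C(ℂ, ℂ))) := by
  rw [pullback_apply, Homeomorph.symm_symm]

/-- The **stretch curve** through the family `F` in the unit direction `u`:
`t ↦ (L_t^{(u)})_* F = (D ↦ (L_t)_* (F (L_t⁻¹ D)))`, the stretched families of Beffara's modulus
(Beffara 2008 §2.2: `L_* F` is what a lattice squeezed by `L` converges to if `F` is the limit on
the unsqueezed one); its velocity at `t = 0` is the tangent vector "infinitesimal stretch
`M_u ∈ sym₀(2)`". [cite: Beffara2008Universal, §2.2] -/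
def stretchCurve (u : ℂ) (hu : ‖u‖ = 1) (F : ChordalFamily) : ℝ → ChordalFamily :=
  fun t => pullback F fun _ => (stretchHomeomorph u hu t).symm

/-- Unfolding `stretchCurve`. [folklore] -/
theorem stretchCurve_apply (u : ℂ) (hu : ‖u‖ = 1) (F : ChordalFamily) (t : ℝ) :
    stretchCurve u hu F t = pullback F fun _ => (stretchHomeomorph u hu t).symm := rfl

/-- The stretch curve passes through `F` at `t = 0`. [folklore] -/
theorem stretchCurve_zero (u : ℂ) (hu : ‖u‖ = 1) (F : ChordalFamily) :
    stretchCurve u hu F 0 = F := by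
  rw [stretchCurve_apply, stretchHomeomorph_zero, Homeomorph.refl_symm, pullback_refl]

/-! ### The exact restriction–Markov class `𝒱` and its lattice-covariant part -/

/-- The **exact restriction–Markov class `𝒱`**: chordal families with EXACTLY two-sided
restriction, a restriction-coupled domain Markov kernel (a Markov extension `Q` whose conditioning
into every Jordan sub-domain `D'` of the remaining domain with `D'.pt 0 =` tip is `P D'`),
reversibility, translation covariance, carried by simple curves meeting `∂D` only at the marked
points — verbatim the hypotheses of the rigidity conjecture R* (route SAWRestrictionRigidity, item
`Rigidity`) with the similarity clause cut down to the translations `z ↦ z + w` (dilations and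
quarter-turns ACT on `𝒱`: its tangent space is graded by the former, and the latter is the
symmetry the sign lemma exploits). The class deformed in Lawler–Schramm–Werner's restriction
theory, without conformal invariance. [cite: LawlerSchrammWerner2003Restriction, §1 and §3 (two-sided restriction)] -/
def exactRestrictionMarkovClass : Set ChordalFamily :=
  {P | P.IsChordal ∧ P.IsRestriction ∧ P.IsRestrictionMarkov ∧ P.IsReversible ∧
    (∀ (D : DobrushinDomain) (w : ℂ),
      P (D.map (similarity 1 one_ne_zero w)) =
        (P D).map (CurveClass.map ((similarity 1 one_ne_zero w : ℂ ≃ₜ ℂ) : C(ℂ, ℂ)))) ∧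
    (∀ D : DobrushinDomain, ∀ᵐ γ ∂(P D),
      γ ∈ CurveClass.simple ∧ γ.range ∩ frontier D.carrier ⊆ {D.pt 0, D.pt 1})}

/-- The **lattice-exact class**: `𝒱` cut down by covariance under all `z ↦ r·i^k·z + w`
(`r > 0`, `k ∈ ℕ`, `w ∈ ℂ`) — exactly the families the hypotheses of R* (`Rigidity`,
stmt-CriticalPhenomena-1368) and `LocalRigidity` (stmt-CriticalPhenomena-4616) quantify over, minus
conjugation (the symmetry a scaling limit along `δℤ²` inherits, Beffara 2008 §2.2). [cite: Beffara2008Universal, §2.2] -/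
def latticeExactClass : Set ChordalFamily :=
  exactRestrictionMarkovClass ∩
    {P | ∀ (D : DobrushinDomain) (c : ℂ) (hc : c ≠ 0) (w : ℂ),
      (∃ (r : ℝ) (k : ℕ), 0 < r ∧ c = (r : ℂ) * Complex.I ^ k) →
        P (D.map (similarity c hc w)) =
          (P D).map (CurveClass.map ((similarity c hc w : ℂ ≃ₜ ℂ) : C(ℂ, ℂ)))}

/-- The lattice-exact class is part of `𝒱`. [folklore] -/
theorem latticeExactClass_subset : latticeExactClass ⊆ exactRestrictionMarkovClass :=
  Set.inter_subset_left

/-! ### Dilation weights and the graded tangent space `T_y(F)` -/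

/-- The deformations of **dilation weight `y`** along `𝒯`: `v` such that for every dilation
`dil r : z ↦ r z` (`r > 0`), every Dobrushin domain and every test observable `f` with
`f ∘ (dil r)_* ∈ 𝒯`, `v (r · D) f = r ^ y · v D (f ∘ (dil r)_*)` — the eigenvectors of eigenvalue
`r ^ y` of the dilation action on deformations (the grading of the card: stretches have weight `0`,
the fugacity / natural-length tilt weight `4/3`). [folklore] -/
def weightDeformations (𝒯 : Set (CurveClass ℂ → ℝ)) (y : ℝ) : Set Deformation :=
  {v | ∀ (r : ℝ) (hr : 0 < r) (D : DobrushinDomain), ∀ f ∈ 𝒯,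
    f ∘ CurveClass.map ((dil r hr.ne' : ℂ ≃ₜ ℂ) : C(ℂ, ℂ)) ∈ 𝒯 →
      v (D.map (dil r hr.ne')) f =
        r ^ y * v D (f ∘ CurveClass.map ((dil r hr.ne' : ℂ ≃ₜ ℂ) : C(ℂ, ℂ)))}

/-- Weight `0` is dilation invariance: first-order covariance under every `z ↦ r z`, `r > 0`
(`Deformation.IsCovariantUnder`). [folklore] -/
theorem mem_weightDeformations_zero_iff (𝒯 : Set (CurveClass ℂ → ℝ)) (v : Deformation) :
    v ∈ weightDeformations 𝒯 0 ↔ ∀ (r : ℝ) (hr : 0 < r), v.IsCovariantUnder 𝒯 (dil r hr.ne') := by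
  simp only [weightDeformations, Set.mem_setOf_eq, Real.rpow_zero, one_mul]
  rfl

/-- **`T_y(F)` along `𝒯` — the weight-`y` tangent space of the exact restriction–Markov class at
`F`**: tangent vectors at `F` of `𝒱` (velocities of `C¹`-along-`𝒯` curves `ε ↦ P^ε` in `𝒱` with
`P⁰ = F`, `ChordalFamily.tangentCone`) of dilation weight `y`. The definition request
RestrictionMarkovTangentSpace (kinematic form; see the module docstring for what the Zariski form
would add). [folklore] -/
def restrictionMarkovTangentSpace (y : ℝ) (𝒯 : Set (CurveClass ℂ → ℝ)) (F : ChordalFamily) :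
    Set Deformation :=
  tangentCone exactRestrictionMarkovClass F 𝒯 ∩ weightDeformations 𝒯 y

/-- Unfolding membership in `T_y(F)`. [folklore] -/
theorem mem_restrictionMarkovTangentSpace_iff (y : ℝ) (𝒯 : Set (CurveClass ℂ → ℝ))
    (F : ChordalFamily) (v : Deformation) :
    v ∈ restrictionMarkovTangentSpace y 𝒯 F ↔
      v ∈ tangentCone exactRestrictionMarkovClass F 𝒯 ∧ v ∈ weightDeformations 𝒯 y :=
  Iff.rfl

/-- `0 ∈ T_y(F)` for every weight as soon as `F ∈ 𝒱` (the constant curve). [folklore] -/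
theorem zero_mem_restrictionMarkovTangentSpace (y : ℝ) (𝒯 : Set (CurveClass ℂ → ℝ))
    {F : ChordalFamily} (hF : F ∈ exactRestrictionMarkovClass) :
    (0 : Deformation) ∈ restrictionMarkovTangentSpace y 𝒯 F :=
  ⟨zero_mem_tangentCone hF, fun r _ D f _ _ => by simp⟩

/-- The **stretch velocities at `F` along `𝒯`** (the image of `sym₀(2) ≅ ℂ`, `q = a · u`): real
multiples of the velocities of the stretch curves `t ↦ (L_t^{(u)})_* F`, `|u| = 1`. IR0 of route
SAWInfinitesimalRigidity in this vocabulary: `restrictionMarkovTangentSpace 0 𝒯 F ⊆ stretchVelocities 𝒯 F`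
for the SLE(8/3) family `F`. (The stretch curve is not required to be `C¹` along `𝒯` here; see the
module docstring.) [cite: Beffara2008Universal, §2.2 and Prop. 4] -/
def stretchVelocities (𝒯 : Set (CurveClass ℂ → ℝ)) (F : ChordalFamily) : Set Deformation :=
  {v | ∃ (a : ℝ) (u : ℂ) (hu : ‖u‖ = 1), v = a • velocity 𝒯 (stretchCurve u hu F)}

/-- `0` is a stretch velocity (multiple `a = 0` of the direction `u = 1`). [folklore] -/
theorem zero_mem_stretchVelocities (𝒯 : Set (CurveClass ℂ → ℝ)) (F : ChordalFamily) :
    (0 : Deformation) ∈ stretchVelocities 𝒯 F :=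
  ⟨0, 1, by simp, (zero_smul ℝ _).symm⟩

/-- Stretch velocities form a cone: stable under real scalings. [folklore] -/
theorem smul_mem_stretchVelocities {𝒯 : Set (CurveClass ℂ → ℝ)} {F : ChordalFamily}
    {v : Deformation} (hv : v ∈ stretchVelocities 𝒯 F) (b : ℝ) :
    b • v ∈ stretchVelocities 𝒯 F := by
  obtain ⟨a, u, hu, rfl⟩ := hv
  exact ⟨b * a, u, hu, (mul_smul b a (velocity 𝒯 (stretchCurve u hu F))).symm⟩


end Summit.CriticalPhenomena.SAWScalingLimit.Theorems.InfinitesimalRigidity
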